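import Literature.NumberTheory.DiophantineGeometry.GenEllBDClasses
import Literature.NumberTheory.DiophantineGeometry.GenEllProjLine
import Literature.NumberTheory.DiophantineGeometry.AbcWave0UniformABCProofs
import Mathlib.Analysis.SpecialFunctions.Pow.Real
import HarnessLib

/-!
# [GenEll] Theorem 2.1 for the projective line minus three points, and the abc dictionary

S. Mochizuki, *Arithmetic elliptic curves in general position*, Math. J. Okayama Univ. 52 (2010)
[cite: MochizukiGenEll2010, Thm 2.1 p.11] (kurims manuscript, Feb. 2009), read on the page (p. 11):

> **Theorem 2.1. (Compactly Bounded Subsets and the ABC Conjecture)** Let `Σ` be a finite set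
> of prime numbers. Then in the terminology of §1 […], the following two statements are equivalent:
> (i) (Effective Mordell/ABC/Vojta Conjecture) Let `X` be a smooth, proper, geometrically
> connected curve over a number field; `D ⊆ X` a reduced divisor; `U_X := X∖D`; `d` a positive
> integer; `ε ∈ ℝ_{>0}` a positive real number. Write `ω_X` for the canonical sheaf on `X`. Suppose
> that `U_X` is a hyperbolic curve — i.e., that the degree of the line bundle `ω_X(D)` is positive.
> Then the inequality of BD-classes of functions `ht_{ω_X(D)} ≲ (1 + ε)(log-diff_X + log-cond_D)`
> holds on `U_X(Q̄)^{≤d}`.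
> (ii) (ABC Conjecture for `Σ`-Supported Compactly Bounded Subsets) Let `P := ℙ¹_ℚ` be the
> projective line over `ℚ`; `C ⊆ P` the divisor consisting of the three points "0", "1", and "∞";
> `U_P := P∖C`; `d` a positive integer; `ε ∈ ℝ_{>0}` a positive real number; `K_V ⊆ U_P(Q̄)` a
> compactly bounded subset [i.e., regarded as a subset of `P(Q̄)` — cf. Example 1.3, (ii)] whose
> support contains `Σ`. Write `ω_P` for the canonical sheaf on `P`. Then the inequality of
> BD-classes of functions `ht_{ω_P(C)} ≲ (1 + ε)(log-diff_P + log-cond_C)` holds on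
> `K_V ∩ U_P(Q̄)^{≤d}`.
> *Proof.* The fact that (i) ⟹ (ii) is immediate from the definitions. […]

## What is here (all over the vocabulary of `GenEllBDClasses` / `GenEllProjLine`)

* `VojtaIneq S d ε` — the displayed inequality of BD-classes on `S ∩ U_P(Q̄)^{≤d}` for
  `(P, C) = (ℙ¹_ℚ, [0]+[1]+[∞])`;
* `ABCCompactlyBounded Σ` — statement (ii), verbatim;
* `VojtaP1Deg d` — statement (i) RESTRICTED to `(X, D) = (ℙ¹_ℚ, [0]+[1]+[∞])` (the only curve the abc
  bridge consumes; the tree has no height machine for general curves — `TODO(general form)`);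
  this is also the `ℙ¹ ∖ {0,1,∞}` case of [IUTchIV] Cor. 2.3 p. 54 (whose statement "coincides
  precisely with the content of [GenEll], Theorem 2.1, (i)", [IUTchIV] p. 54) — a predicate here,
  asserted by nobody;
* `abcCompactlyBounded_of_vojtaP1Deg` — (i)|_{ℙ¹} ⟹ (ii), "immediate from the definitions", PROVED;
* `GenEll_thm21` — the NAMED FACT (ii) ⟹ (i)|_{ℙ¹} (the substantial direction, via noncritical
  Belyi maps [GenEll] pp. 11–13; special case `X = ℙ¹` of the printed (ii) ⟹ (i));
* the **abc dictionary** for `ℚ`-points, PROVED: for an abc triple `(a, b, c)` and the point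
  `λ = a/c ∈ U_P(ℚ)`: `ht = log c`, `log-diff = 0`, `log-cond = log rad(abc)`
  (`ht_ratPoint_triple`, `logDiff_ratPoint`, `logCond_ratPoint_triple`);
* `abc_of_vojtaIneq_one` — the `d = 1` case of (i)|_{ℙ¹} implies, word for word, the displayed
  sentence of the summit statement `ABC` (`Summits/ABC/ABC/Statement.lean`, which `Literature/`
  cannot import): `∀ ε > 0, ∃ C > 0, ∀ abc triples, c < C · rad(abc)^{1+ε}` — PROVED; hence
  `abc_of_vojtaP1Deg`, and `abc_of_abcCompactlyBounded : GenEll_thm21 → ABCCompactlyBounded Σ → (abc)`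
  — the campaign-S endpoint `[IUTchIV] Cor 2.2 ⇒ (ii)_{Σ={2}} ⇒ [GenEll 2.1] (i) ⇒ abc`,
  kernel-checked modulo the one named fact `GenEll_thm21`.

Scholze–Stix grant this reduction: "The abc-conjecture is a special case for the projective line
`ℙ¹_ℚ` with respect to the divisor `D = 0 + 1 + ∞` of Vojta's height inequality" (Scholze–Stix 2018,
§1.1 p. 1; not part of the IUT dispute).
-/

noncomputable section

open NumberField IsDedekindDomain

namespace Literature.NumberTheory.DiophantineGeometry.GenEll

/-! ## The statements -/

/-- The inequality of BD-classes `ht_{ω_P(C)} ≲ (1 + ε)(log-diff_P + log-cond_C)` "on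
`S ∩ U_P(Q̄)^{≤d}`", for `(P, C) = (ℙ¹_ℚ, [0]+[1]+[∞])` and a set `S` of points (`S = U_P(Q̄)` in
(i), `S = K_V` in (ii)). [cite: MochizukiGenEll2010, Thm 2.1 p.11] -/
def VojtaIneq (S : Set NFPoint) (d : ℕ) (ε : ℝ) : Prop :=
  BDLe (S ∩ UPle d) NFPoint.ht (fun P => (1 + ε) * (P.logDiff + P.logCond))

/-- **Statement (ii) of [GenEll] Thm. 2.1** for the finite set of primes `Σ = S`: for every positive
integer `d`, every `ε > 0` and every compactly bounded subset `K_V ⊆ U_P(Q̄)` whose support contains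
`Σ`, the inequality of BD-classes `ht_{ω_P(C)} ≲ (1+ε)(log-diff_P + log-cond_C)` holds on
`K_V ∩ U_P(Q̄)^{≤d}` (the paper's heading for (ii) is quoted verbatim in the module docstring). A
predicate; nothing is asserted. [cite: MochizukiGenEll2010, Thm 2.1 (ii) p.11] -/
def ABCCompactlyBounded (S : Finset ℕ) : Prop :=
  ∀ d : ℕ, 0 < d → ∀ ε : ℝ, 0 < ε → ∀ D : CBData, D.SupportContains S → VojtaIneq D.toSet d ε

/-- **Statement (i) of [GenEll] Thm. 2.1 for the hyperbolic curve `(X, D) = (ℙ¹_ℚ, [0]+[1]+[∞])`**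
(`deg ω_X(D) = 1 > 0`) **and the positive integer `d`**: for every `ε > 0`, the inequality of
BD-classes `ht_{ω_P(C)} ≲ (1+ε)(log-diff_P + log-cond_C)` holds on `U_P(Q̄)^{≤d}`. This is the
`ℙ¹ ∖ {0,1,∞}` case of the display of [IUTchIV] Cor. 2.3 (p. 54: "coincides precisely with the
content of [GenEll], Theorem 2.1, (i)"). A predicate; nothing is asserted. TODO(general form):
(i) for every hyperbolic curve `(X, D)` over a number field needs `ht_{ω_X(D)}`, `log-diff_X`,
`log-cond_D` on general arithmetic surfaces ([GenEll] Def. 1.1–1.5), which the tree does not have.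
[cite: MochizukiGenEll2010, Thm 2.1 (i) p.11] -/
def VojtaP1Deg (d : ℕ) : Prop :=
  ∀ ε : ℝ, 0 < ε → VojtaIneq Set.univ d ε

/-- **(i) ⟹ (ii)** of [GenEll] Thm. 2.1 (for `(ℙ¹_ℚ, [0]+[1]+[∞])`): "immediate from the
definitions" — a BD-inequality on `U_P(Q̄)^{≤d}` restricts to `K_V ∩ U_P(Q̄)^{≤d}`. PROVED.
[cite: MochizukiGenEll2010, Thm 2.1 p.11] -/
theorem abcCompactlyBounded_of_vojtaP1Deg (h : ∀ d : ℕ, 0 < d → VojtaP1Deg d) (S : Finset ℕ) :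
    ABCCompactlyBounded S :=
  fun d hd ε hε _ _ => (h d hd ε hε).mono (Set.inter_subset_inter_left _ (Set.subset_univ _))

/-- NAMED FACT — **[GenEll] Theorem 2.1, direction (ii) ⟹ (i)**, with (i) specialised to
`X = ℙ¹_ℚ`, `D = [0]+[1]+[∞]`: for every finite set `Σ` of prime numbers, statement (ii) for `Σ`
implies statement (i)|_{ℙ¹} for every positive integer `d` (hence for every `ε > 0`,
`ht_{ω_P(C)} ≲ (1+ε)(log-diff_P + log-cond_C)` on all of `U_P(Q̄)^{≤d}`). Printed proof: noncritical
Belyi maps, [GenEll] pp. 11–13 (with the corrections of [IUTchIV] Rmk. 2.3.1 (v)); refereed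
(Math. J. Okayama Univ. 52 (2010)); granted by Scholze–Stix 2018 §1.2 and outside the IUT dispute.
TODO(general form): the printed (ii) ⟹ (i) concludes (i) for ALL hyperbolic curves.
**RETIRED — DO NOT CONSUME (audit A-Sd2-F1, 2026-08-25):** this transcription drops the printed
binder "Let `Σ` be a finite set of PRIME numbers"; since `CBData.primes_prime` makes
`ABCCompactlyBounded Σ` vacuously true for a `Σ` containing a non-prime (e.g. `Σ = {4}`), the `Prop`
below is ABC-STRENGTH AS TYPED (it yields (i)|_{ℙ¹} outright; kernel witness by abc-iut-S-d2). The
faithful transcription is `GenEll_thm21_primes` (this file); `GenEll_thm21 → GenEll_thm21_primes`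
(`GenEll_thm21_primes_of`). The declaration is kept unchanged only because landed consumers quote it.
[cite: MochizukiGenEll2010, Thm 2.1 p.11] -/
def GenEll_thm21 : Prop :=
  ∀ S : Finset ℕ, ABCCompactlyBounded S → ∀ d : ℕ, 0 < d → VojtaP1Deg d

/-- NAMED FACT (FAITHFUL transcription; audit A-Sd2-F1 repair, append-only form) — **[GenEll]
Theorem 2.1, direction (ii) ⟹ (i)**, with (i) specialised to `X = ℙ¹_ℚ`, `D = [0]+[1]+[∞]`:
"Let `Σ` be a finite set of prime numbers" (p. 11) — for every finite set `Σ` of PRIME numbers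
(the binder `(∀ p ∈ Σ, p.Prime)` is load-bearing, see `GenEll_thm21`), statement (ii) for `Σ`
implies statement (i)|_{ℙ¹} for every positive integer `d`. Printed proof: noncritical Belyi maps,
[GenEll] pp. 11–13 (with the corrections of [IUTchIV] Rmk. 2.3.1 (v)); refereed (Math. J. Okayama
Univ. 52 (2010)); granted by Scholze–Stix 2018 §1.2 and outside the IUT dispute. This is the fact
consumers take as a hypothesis. TODO(general form): the printed (ii) ⟹ (i) concludes (i) for ALL
hyperbolic curves. [cite: MochizukiGenEll2010, Thm 2.1 p.11] -/
def GenEll_thm21_primes : Prop :=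
  ∀ S : Finset ℕ, (∀ p ∈ S, p.Prime) → ABCCompactlyBounded S → ∀ d : ℕ, 0 < d → VojtaP1Deg d

/-- The retired transcription implies the faithful one (so nothing proved from `GenEll_thm21_primes`
is weaker than what was proved from `GenEll_thm21`). [cite: MochizukiGenEll2010, Thm 2.1 p.11] -/
theorem GenEll_thm21_primes_of (h : GenEll_thm21) : GenEll_thm21_primes :=
  fun S _ hS d hd => h S hS d hd

/-! ## The abc dictionary for `ℚ`-points of `ℙ¹ ∖ {0, 1, ∞}` -/

section Dictionary

variable {a b c : ℕ}

/-- For an abc triple, `gcd(a, c) = gcd(a, a + b) = gcd(a, b) = 1`. [folklore] -/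
private theorem coprime_ac (h : IsABCTriple a b c) : Nat.Coprime a c := by
  obtain ⟨-, -, habc, hcop⟩ := h
  rw [← habc, Nat.coprime_self_add_right]
  exact hcop

/-- For an abc triple, `c = a + b > 0`. [folklore] -/
private theorem pos_c (h : IsABCTriple a b c) : 0 < c := by
  obtain ⟨ha, -, habc, -⟩ := h
  omega

/-- The point `λ = a/c ∈ U_P(ℚ)` of an abc triple: `a/c ≠ 0, 1`, so it lies in `U_P(Q̄)^{≤1}`.
[cite: MochizukiGenEll2010, Thm 2.1 (ii) p.11] -/
theorem ratPoint_triple_mem (h : IsABCTriple a b c) : ratPoint ((a : ℚ) / c) ∈ UPle 1 := by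
  have ha : 0 < a := h.1
  have hc : 0 < c := pos_c h
  refine ratPoint_mem_UPle_one ?_ ?_
  · positivity
  · intro h1
    rw [div_eq_one_iff_eq (by exact_mod_cast hc.ne')] at h1
    have : a = c := by exact_mod_cast h1
    have := h.2.1
    have := h.2.2.1
    omega

/-- **Dictionary, height.** For an abc triple, `ht_{ω_P(C)}(a/c) = h(a/c) = log max(a, c) = log c`
(Mathlib `Rat.logHeight₁_eq_log_max`). [cite: MochizukiGenEll2010, Def 1.2 (i) p.5] -/
theorem ht_ratPoint_triple (h : IsABCTriple a b c) :
    (ratPoint ((a : ℚ) / c)).ht = Real.log c := by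
  have hc : 0 < c := pos_c h
  have hcop : Nat.Coprime a c := coprime_ac h
  have hle : a ≤ c := by have := h.2.2.1; omega
  change ((Module.finrank ℚ ℚ : ℕ) : ℝ)⁻¹ * Height.logHeight₁ ((a : ℚ) / c) = Real.log c
  rw [Module.finrank_self, Nat.cast_one, inv_one, one_mul, Rat.logHeight₁_eq_log_max]
  have hq : ((a : ℚ) / c) = ((a : ℤ) : ℚ) / ((c : ℤ) : ℚ) := by push_cast; rfl
  have hnum : (((a : ℤ) : ℚ) / ((c : ℤ) : ℚ)).num = a :=
    Rat.num_div_eq_of_coprime (by exact_mod_cast hc) (by simpa using hcop)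
  have hden : ((((a : ℤ) : ℚ) / ((c : ℤ) : ℚ)).den : ℤ) = c :=
    Rat.den_div_eq_of_coprime (by exact_mod_cast hc) (by simpa using hcop)
  rw [hq, hnum]
  have hden' : (((a : ℤ) : ℚ) / ((c : ℤ) : ℚ)).den = c := by exact_mod_cast hden
  rw [hden', Int.natAbs_natCast, max_eq_right hle]

/-- **Dictionary, log-different.** `log-diff_P` vanishes on `ℚ`-points: the different of `ℚ` is
trivial (`N(𝔡_ℚ) = |disc ℚ| = 1`). [cite: MochizukiGenEll2010, Def 1.5 (iii) p.8] -/
theorem logDiff_ratPoint (q : ℚ) : (ratPoint q).logDiff = 0 := by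
  rw [NFPoint.logDiff_eq_log_discr]
  change ((Module.finrank ℚ ℚ : ℕ) : ℝ)⁻¹ * Real.log ((NumberField.discr ℚ).natAbs : ℕ) = 0
  rw [Rat.numberField_discr]
  simp

/-- The bad primes of `(a/c : 1 − a/c : 1) = (a/c : b/c : 1)` are those of `(a : b : c)`
(projective invariance). [cite: MochizukiGenEll2010, Def 1.5 (iv) p.8] -/
private theorem badPrimes_triple (h : IsABCTriple a b c) :
    badPrimes ((a : ℚ) / c) (1 - (a : ℚ) / c) 1 = badPrimes (a : ℚ) (b : ℚ) (c : ℚ) := by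
  have hc : 0 < c := pos_c h
  have hc0 : (c : ℚ) ≠ 0 := by exact_mod_cast hc.ne'
  have hb : 1 - (a : ℚ) / c = (b : ℚ) / c := by
    have habc : (a : ℚ) + b = c := by exact_mod_cast h.2.2.1
    field_simp
    linarith
  rw [hb]
  ext v
  simp only [badPrimes, Set.mem_setOf_eq, map_div₀, map_one]
  have hvc : v.valuation ℚ (c : ℚ) ≠ 0 := (Valuation.ne_zero_iff _).mpr hc0
  rw [div_left_inj' hvc, div_eq_one_iff_eq hvc]

/-- **Dictionary, log-conductor.** For an abc triple, `log-cond_{[0]+[1]+[∞]}(a/c) = log rad(abc)`: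
the point `λ = a/c` meets `0` at the primes dividing `a`, `∞` at the primes dividing `c`, and `1`
at the primes dividing `λ − 1 = −b/c`, i.e. dividing `b`; each contributes `log p`
(tree: `radicalNorm_natCast_eq_rad` of `AbcWave0UniformABCProofs`). [cite: MochizukiGenEll2010, Def 1.5 (iv) p.8] -/
theorem logCond_ratPoint_triple (h : IsABCTriple a b c) :
    (ratPoint ((a : ℚ) / c)).logCond = Real.log (rad a b c) := by
  rw [NFPoint.logCond_eq]
  change ((Module.finrank ℚ ℚ : ℕ) : ℝ)⁻¹ *
      Real.log (radicalNorm ((a : ℚ) / c) (1 - (a : ℚ) / c) 1) = Real.log (rad a b c)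
  rw [Module.finrank_self, Nat.cast_one, inv_one, one_mul]
  have hrn : radicalNorm ((a : ℚ) / c) (1 - (a : ℚ) / c) 1 =
      radicalNorm (a : ℚ) (b : ℚ) (c : ℚ) := by
    unfold radicalNorm
    rw [badPrimes_triple h]
  rw [hrn, UniformABCConjecture.radicalNorm_natCast_eq_rad h]

end Dictionary

/-! ## The bridge to the abc sentence -/

/-- **(i)|_{ℙ¹} at `d = 1` ⟹ the abc inequality of Masser–Oesterlé (strong form).** If for every
`ε > 0` the inequality `ht_{ω_P(C)} ≲ (1+ε)(log-diff_P + log-cond_C)` holds on `U_P(Q̄)^{≤1} ⊇ U_P(ℚ)`,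
then `∀ ε > 0, ∃ C > 0, ∀ abc triples (a,b,c), c < C · rad(abc)^{1+ε}` — word for word the displayed
sentence of the summit statement `ABC` (`Summits/ABC/ABC/Statement.lean`, Bombieri–Gubler 12.2.2).
Via the dictionary: `log c ≤ (1+ε)·(0 + log rad(abc)) + K`, exponentiate. Scholze–Stix 2018 §1.1
p. 1: the abc problem "is a special case for the projective line `ℙ¹_ℚ` with respect to the divisor
`D = 0 + 1 + ∞` of Vojta's height inequality". PROVED. [cite: MochizukiGenEll2010, Thm 2.1 p.11] -/
theorem abc_of_vojtaIneq_one (h : ∀ ε : ℝ, 0 < ε → VojtaIneq Set.univ 1 ε) :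
    ∀ ε : ℝ, 0 < ε → ∃ C : ℝ, 0 < C ∧
      ∀ a b c : ℕ, IsABCTriple a b c → (c : ℝ) < C * ((rad a b c : ℕ) : ℝ) ^ (1 + ε) := by
  intro ε hε
  obtain ⟨K, hK⟩ := h ε hε
  refine ⟨Real.exp K + 1, by positivity, fun a b c ht => ?_⟩
  have hc : 0 < c := pos_c ht
  have hc0 : (0 : ℝ) < c := by exact_mod_cast hc
  have hmem : ratPoint ((a : ℚ) / c) ∈ Set.univ ∩ UPle 1 :=
    ⟨Set.mem_univ _, ratPoint_triple_mem ht⟩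
  have hineq := hK _ hmem
  simp only at hineq
  rw [ht_ratPoint_triple ht, logDiff_ratPoint, logCond_ratPoint_triple ht, zero_add] at hineq
  -- `hineq : log c - (1 + ε) * log rad ≤ K`
  have hr0 : (0 : ℝ) < (rad a b c : ℝ) := by
    have : 0 < rad a b c := by
      rw [rad_def]; exact Nat.pos_of_ne_zero UniqueFactorizationMonoid.radical_ne_zero
    exact_mod_cast this
  have hexp : (c : ℝ) ≤ Real.exp K * (rad a b c : ℝ) ^ (1 + ε) := by
    have e1 : (c : ℝ) = Real.exp (Real.log c) := (Real.exp_log hc0).symm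
    have e2 : ((rad a b c : ℕ) : ℝ) ^ (1 + ε) = Real.exp (Real.log (rad a b c) * (1 + ε)) :=
      Real.rpow_def_of_pos hr0 _
    rw [e1, e2, ← Real.exp_add]
    apply Real.exp_le_exp.mpr
    linarith
  have hpow : 0 < ((rad a b c : ℕ) : ℝ) ^ (1 + ε) := Real.rpow_pos_of_pos hr0 _
  calc (c : ℝ) ≤ Real.exp K * (rad a b c : ℝ) ^ (1 + ε) := hexp
    _ < (Real.exp K + 1) * (rad a b c : ℝ) ^ (1 + ε) := by nlinarith

/-- **(i)|_{ℙ¹} ⟹ abc**: statement (i) of [GenEll] Thm. 2.1 for `ℙ¹ ∖ {0,1,∞}` and all positive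
integers `d` (equivalently the `ℙ¹` case of [IUTchIV] Cor. 2.3) implies the abc sentence, by the
`d = 1` case. PROVED. [cite: MochizukiGenEll2010, Thm 2.1 p.11] -/
theorem abc_of_vojtaP1Deg (h : ∀ d : ℕ, 0 < d → VojtaP1Deg d) :
    ∀ ε : ℝ, 0 < ε → ∃ C : ℝ, 0 < C ∧
      ∀ a b c : ℕ, IsABCTriple a b c → (c : ℝ) < C * ((rad a b c : ℕ) : ℝ) ^ (1 + ε) :=
  abc_of_vojtaIneq_one (h 1 one_pos)

/-- **The campaign-S endpoint, modulo the named fact [GenEll] Thm. 2.1**: statement (ii) for some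
finite set of primes `Σ` (what [IUTchIV] Cor. 2.2 is used to deliver for `Σ = {2}` in the proof of
[IUTchIV] Cor. 2.3, p. 55) implies the abc sentence. PROVED modulo `GenEll_thm21`, taken as an
explicit hypothesis. [cite: MochizukiGenEll2010, Thm 2.1 p.11] -/
theorem abc_of_abcCompactlyBounded (hfact : GenEll_thm21) {S : Finset ℕ}
    (h : ABCCompactlyBounded S) :
    ∀ ε : ℝ, 0 < ε → ∃ C : ℝ, 0 < C ∧
      ∀ a b c : ℕ, IsABCTriple a b c → (c : ℝ) < C * ((rad a b c : ℕ) : ℝ) ^ (1 + ε) :=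
  abc_of_vojtaP1Deg (hfact S h)

/-! ## The `Σ = {2}` specialisations (the only instance the [IUTchIV] Cor. 2.2 ⇒ Cor. 2.3 route uses) -/

/-- **(ii) for `Σ = {2}` ⟹ (i)|_{ℙ¹}**, via the named fact `GenEll_thm21` at the set of PRIME numbers
`{2}`. Consumers (`Corollary23Chain`, `Summits/ABC/IUTFork/GenEllAbc`) should go through this lemma
rather than apply `GenEll_thm21` to a raw `Finset ℕ`: the fact is only as printed ("`Σ` a finite set
of prime numbers", p. 11) once its set argument is restricted to primes (audit A-Sd2-F1), and this
lemma is stable under that repair. [cite: MochizukiGenEll2010, Thm 2.1 p.11] -/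
theorem vojtaP1Deg_of_abcCompactlyBounded_two (hfact : GenEll_thm21)
    (h : ABCCompactlyBounded ({2} : Finset ℕ)) {d : ℕ} (hd : 0 < d) : VojtaP1Deg d :=
  hfact {2} h d hd

/-- **(ii) for `Σ = {2}` ⟹ abc**, via the named fact `GenEll_thm21` at the set of prime numbers `{2}`
(see `vojtaP1Deg_of_abcCompactlyBounded_two`). [cite: MochizukiGenEll2010, Thm 2.1 p.11] -/
theorem abc_of_abcCompactlyBounded_two (hfact : GenEll_thm21)
    (h : ABCCompactlyBounded ({2} : Finset ℕ)) :
    ∀ ε : ℝ, 0 < ε → ∃ C : ℝ, 0 < C ∧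
      ∀ a b c : ℕ, IsABCTriple a b c → (c : ℝ) < C * ((rad a b c : ℕ) : ℝ) ^ (1 + ε) :=
  abc_of_vojtaP1Deg fun _ hd => vojtaP1Deg_of_abcCompactlyBounded_two hfact h hd


/-! ## The `Σ = {2}` specialisations of the FAITHFUL fact (what the Cor. 2.2 ⇒ Cor. 2.3 route consumes) -/

/-- **(ii) for `Σ = {2}` ⟹ (i)|_{ℙ¹}**, via the faithful named fact `GenEll_thm21_primes` at the set of
PRIME numbers `{2}` (`Nat.prime_two`). [cite: MochizukiGenEll2010, Thm 2.1 p.11] -/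
theorem vojtaP1Deg_of_abcCompactlyBounded_two_primes (hfact : GenEll_thm21_primes)
    (h : ABCCompactlyBounded ({2} : Finset ℕ)) {d : ℕ} (hd : 0 < d) : VojtaP1Deg d :=
  hfact {2} (fun p hp => by rw [Finset.mem_singleton] at hp; subst hp; exact Nat.prime_two) h d hd

/-- **(ii) for `Σ = {2}` ⟹ abc**, via the faithful named fact `GenEll_thm21_primes`.
[cite: MochizukiGenEll2010, Thm 2.1 p.11] -/
theorem abc_of_abcCompactlyBounded_two_primes (hfact : GenEll_thm21_primes)
    (h : ABCCompactlyBounded ({2} : Finset ℕ)) :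
    ∀ ε : ℝ, 0 < ε → ∃ C : ℝ, 0 < C ∧
      ∀ a b c : ℕ, IsABCTriple a b c → (c : ℝ) < C * ((rad a b c : ℕ) : ℝ) ^ (1 + ε) :=
  abc_of_vojtaP1Deg fun _ hd => vojtaP1Deg_of_abcCompactlyBounded_two_primes hfact h hd

/-- **(ii) ⟹ abc, modulo the faithful named fact**: for a finite set `Σ` of PRIME numbers, statement (ii)
for `Σ`-supported compactly bounded subsets of `ℙ¹ ∖ {0,1,∞}` implies the abc sentence, PROVED modulo
`GenEll_thm21_primes`. [cite: MochizukiGenEll2010, Thm 2.1 p.11] -/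
theorem abc_of_abcCompactlyBounded_primes (hfact : GenEll_thm21_primes) {S : Finset ℕ}
    (hS : ∀ p ∈ S, p.Prime) (h : ABCCompactlyBounded S) :
    ∀ ε : ℝ, 0 < ε → ∃ C : ℝ, 0 < C ∧
      ∀ a b c : ℕ, IsABCTriple a b c → (c : ℝ) < C * ((rad a b c : ℕ) : ℝ) ^ (1 + ε) :=
  abc_of_vojtaP1Deg (hfact S hS h)

end Literature.NumberTheory.DiophantineGeometry.GenEll

end
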